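import Summits.AnomalousDissipation.AnomalousDissipation.Theses.LandauJetArena
import Literature.Analysis.FunctionSpaces.TorusLerayHelmholtzProofs

/-!
# `LandauJetArena.JetPairForceExists` (stmt-AnomalousDissipation-1546): the jet-pair class is non-empty

Route `AnomalousDissipation/LandauJetArena`, support item stmt-AnomalousDissipation-1546: for every
admissible `(ρ, a, φ)` there is a force `f` with `JetPair(ρ, a, φ, f)`, i.e. `f` smooth, divergence
free, mean zero, and `∫⟪f, w⟫ = ∫ (φ(x − a) − φ(x + a)) w₃` for every smooth divergence-free `w`.

Proof. Put `G := (φ(· − a) − φ(· + a)) • e₃`, a smooth vector field on `T³`. By the (discharged) smooth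
Helmholtz–Weyl decomposition `Literature.Analysis.FunctionSpaces.Torus.smooth_helmholtz_holds`
(Robinson–Rodrigo–Sadowski 2016, Thm. 2.6 (ii); file `TorusLerayHelmholtzProofs`) `G = w₀ + ∇φ₀` with
`w₀` smooth and divergence free and `φ₀` smooth; take `f := w₀` (the Leray projection of `G` plus its
mean, and the mean vanishes). Mean zero: `∫ w₀ = ∫ G` (`Torus.integral_add_gradient`, gradients have
zero mean) and `∫ (φ(x − a) − φ(x + a)) = ∫φ − ∫φ = 0` by translation invariance of Haar measure on
`T³`. Orthogonality clause: `∫⟪w₀, w⟫ = ∫⟪G, w⟫ − ∫⟪∇φ₀, w⟫ = ∫⟪G, w⟫` for smooth divergence-free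
`w` (`Torus.integral_inner_gradient_eq_zero_of_isDivFree`, integration by parts), and
`⟪G x, w x⟫ = (φ(x − a) − φ(x + a)) ⟪w x, e₃⟫` pointwise.
-/

-- `Summit.<Summit>.<Problem>` is the tree's mandated summit-side namespace (CONVENTIONS §2); for this
-- single-conjunct summit the two coincide, so the duplicate is deliberate.
set_option linter.dupNamespace false

noncomputable section

open scoped InnerProductSpace
open MeasureTheory

namespace Summit.AnomalousDissipation.AnomalousDissipation.Theorems

open Literature.Analysis.FunctionSpaces Literature.Analysis.FunctionSpaces.Torus
open Summit.AnomalousDissipation.AnomalousDissipation.Theses.LandauJetArena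

/-- Settles stmt-AnomalousDissipation-1546 (`LandauJetArena.JetPairForceExists`, support): for every
admissible `(ρ, a, φ)` the jet-pair class is non-empty — `f` is the solenoidal part `w₀` of the smooth
Helmholtz–Weyl split `(φ(· − a) − φ(· + a)) • e₃ = w₀ + ∇φ₀`
(`Literature.Analysis.FunctionSpaces.Torus.smooth_helmholtz_holds`, Robinson–Rodrigo–Sadowski 2016
Thm. 2.6 (ii)); it is smooth and divergence free by construction, mean zero because gradients have zero
mean and `∫ φ(· − a) = ∫ φ(· + a)` (translation invariance), and `∫⟪f, w⟫ = ∫ (φ(x − a) − φ(x + a)) w₃`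
for smooth divergence-free `w` because `∫⟪∇φ₀, w⟫ = 0`. [folklore] -/
theorem jetPairForceExists_proof :
    Summit.AnomalousDissipation.AnomalousDissipation.Theses.LandauJetArena.JetPairForceExists := by
  unfold JetPairForceExists
  intro ρ a φ hρ ha hφ hφnn hφsupp hφint
  -- the scalar amplitude and the monopole-pair field `G = g • e₃`
  set e₃ : EuclideanSpace ℝ (Fin 3) := EuclideanSpace.single (2 : Fin 3) (1 : ℝ) with he₃
  set g : UnitAddTorus (Fin 3) → ℝ := fun x => φ (x - a) - φ (x + a) with hg_def
  have hg : IsSmooth g := by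
    have h1 : IsSmooth (fun x => φ (x - a)) := by
      simpa only [sub_eq_add_neg] using hφ.comp_add_right (-a)
    exact h1.sub (hφ.comp_add_right a)
  have hG : IsSmooth (fun x => g x • e₃) := hg.smul' (isSmooth_const e₃)
  obtain ⟨w₀, φ₀, hw₀, hφ₀, hdiv, -, hdec⟩ := smooth_helmholtz_holds (d := Fin 3) _ hG
  -- `∫ g = 0` by translation invariance of the Haar measure
  have hg_int : ∫ x, g x = 0 := by
    have h1 : ∫ x, φ (x - a) = ∫ x, φ x :=
      integral_sub_right_eq_self (μ := (volume : Measure (UnitAddTorus (Fin 3)))) φ a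
    have h2 : ∫ x, φ (x + a) = ∫ x, φ x :=
      integral_add_right_eq_self (μ := (volume : Measure (UnitAddTorus (Fin 3)))) φ a
    have hi1 : Integrable (fun x => φ (x - a)) volume := by
      simpa only [sub_eq_add_neg] using (hφ.comp_add_right (-a)).integrable
    have hi2 : Integrable (fun x => φ (x + a)) volume := (hφ.comp_add_right a).integrable
    simp only [hg_def]
    rw [integral_sub hi1 hi2, h1, h2, sub_self]
  -- `w₀ = G - ∇φ₀` pointwise
  have hw₀_eq : ∀ x, w₀ x = g x • e₃ - Torus.gradient φ₀ x := fun x => by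
    rw [hdec x, add_sub_cancel_right]
  refine ⟨w₀, hρ, ha, hφ, hφnn, hφsupp, hφint, hw₀, hdiv, ?_, ?_⟩
  · -- mean zero
    show ∫ x, w₀ x = 0
    rw [← integral_add_gradient hw₀ hφ₀]
    simp_rw [← hdec]
    rw [integral_smul_const, hg_int, zero_smul]
  · -- the orthogonality clause
    intro w hw hdivw
    have hi1 : Integrable (fun x => ⟪g x • e₃, w x⟫_ℝ) volume := (hG.inner hw).integrable
    have hi2 : Integrable (fun x => ⟪Torus.gradient φ₀ x, w x⟫_ℝ) volume :=
      (hφ₀.gradient.inner hw).integrable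
    simp_rw [hw₀_eq, inner_sub_left]
    rw [integral_sub hi1 hi2, integral_inner_gradient_eq_zero_of_isDivFree hw hφ₀ hdivw, sub_zero]
    refine integral_congr_ae (Filter.Eventually.of_forall fun x => ?_)
    simp only [hg_def]
    rw [real_inner_smul_left, real_inner_comm]

end Summit.AnomalousDissipation.AnomalousDissipation.Theorems

end
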